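/-
Copyright (c) 2026 the pub-hodgecm-mathlib formalisation cell (harness21).  Prover seat hodgecm-mathlib-K2E5-p16 (g7), Track B «K2-LIT»,
#184♮ = hLiu418 = `stmt-HodgeConjecture-24832`; S2-asm road (γ) packaging, FRAME BLOCK FILE 1 (K2E5-p16 (g7) frame census 15:0xZ, plan (A)): the Shimura tube
frame of ★ `K2LiuHermitianTubeFrame` is ADAPTED to the sign frame.  THEOREMS ONLY (no `def`, no `instance`, no notation, no `sorry`).
-/
import Summits.HodgeConjecture.HodgeConjecture.Theorems.K2LiuHermitianTubeFrameWeyl   -- ★ `exists_tubeFrame₃` and the letters of ★ `K2LiuHermitianTubeFrame`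
import HarnessLib

/-!
# Crux `HLiu418`, Road (γ) frame block: the Shimura tube frame is sign-adapted — `Tᴴ T = |H|` and the sign-sorted form of `T⁻¹ κ(k₁,k₂) T`

Cell `hodgecm-mathlib`, crux item hLiu418 = `stmt-HodgeConjecture-24832` (helper lane `--supports`, count-neutral).
LETTERS (★ `K2LiuHermitianTubeFrame` §3, BY VALUE): `t : l → ℝ` nowhere zero, `d_i = √(|t_i|∕2)`, `e_i = t_i∕|t_i|`, `D = diag(d)`, `C₀ = diag(i e d)`, `P₀ = diag(d⁻¹∕2)`,
`P₁ = diag(i d⁻¹ e∕2)`, `T = (D D; C₀ −C₀)`, `T⁻¹ = (P₀ −P₁; P₀ P₁)`; the Cayley unit `T₁ = (1 1; i·1 −i·1)`, `½T₁′` of ★ `K2LiuArchFrameBridge`'s chart `κ(k₁,k₂) = T₁·diag(k₁,k₂)·½T₁′`.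
* §1–§2 block and diagonal letters (`T⁻¹ T₁`, `½T₁′ T`, `P₀ ∓ iP₁ = diag((1±e)d⁻¹∕2)`, `D ∓ iC₀ = diag((1±e)d)`, `e_i = ±1` by the sign of `t_i`);
* §3 **`frameInv_kappa_frame`** — THE SIGN-SORTED FORM of `T⁻¹ κ(k₁,k₂) T`: entries `(d_j∕d_i)·(k₁)_{ij}` on pairs of indices of the slot `{inl i : 0 < t_i} ∪ {inr i : t_i < 0}`,
  `(d_j∕d_i)·(k₂)_{ij}` on the complementary slot, `0` across (so the reading points `ι_w κ(1, v)` have SIGN-SEPARATED place components);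
* §4 **`frame_conjTranspose_mul_frame`** — `Tᴴ T = diag|t| ⊕ diag|t|` (the frame carries the `|H|`-majorant's unitary group, the sign-frame maximal compact, onto `Stab(i1)`);
* §5 **`exists_tubeFrame₄`**, **`exists_tubeFrame_arch₄`** — ★ `exists_tubeFrame₃` ∕ ★ `exists_tubeFrame_arch₃` (i)–(vii) for ONE frame PLUS (x) the frame made EXPLICIT
  (`T = …`, `T⁻¹ = …`), so that §3–§4 apply to the packaged frame by `subst` — the SAME frame that carries (law)∕(der) of the S2 (γ) packaging.
FILE 2 of the frame block reads off §3 the letter `archUFormPi_𝔻 (ι_w κ(k₁,k₂)) σ = kV (α, β)` (`det`s `= det k₁, det k₂` in the order fixed by the sign of `deltaIm σ`) —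
the `hfr∕hα∕hβ` of ★ `K2LiuArchSWAnchorCharacter`, i.e. (hanc) of ★ `K2LiuArchSWMultiPlaceRegion.prod_anchor_mem`.
References: [Shimura1997, §§5–6 (Case UT: the Cayley frame), §6.5]; [KonnoKonno2007, §3.1]; [Folland1989, §4.2 Prop. (4.39)].
HONEST LABEL: HC_CM is proved only modulo the 7 printed citations (2 remaining named inputs: hLiu418 = stmt-HodgeConjecture-24832,
h413 = stmt-HodgeConjecture-24833) until rung 0 closes; count-neutral helper, closes no socket.
-/

set_option autoImplicit false
set_option linter.dupNamespace false

namespace Summit.HodgeConjecture.HodgeConjecture.Cruxes.HLiu418.K2LiuHermitianTubeFrameSign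

open Matrix Complex
open scoped MatrixGroups ComplexConjugate
open K2LiuHermitianTubeCocycle K2LiuHermitianTubeFrame K2LiuHermitianTubeFrameWeyl

variable {l : Type*} [Fintype l] [DecidableEq l]

/-! ## §1 Block letters: `T⁻¹ T₁`, `½T₁′ T`, and `T⁻¹ κ(k₁,k₂) T` -/

/-- `T⁻¹ · T₁ = (P₀ − iP₁, P₀ + iP₁; P₀ + iP₁, P₀ − iP₁)`. [cite: Shimura1997, §6.5] -/
theorem frameInv_mul_cayley (P₀ P₁ : Matrix l l ℂ) :
    fromBlocks P₀ (-P₁) P₀ P₁ * (fromBlocks 1 1 (I • 1) (-(I • 1)) : Matrix (l ⊕ l) (l ⊕ l) ℂ) =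
      fromBlocks (P₀ - I • P₁) (P₀ + I • P₁) (P₀ + I • P₁) (P₀ - I • P₁) := by
  rw [fromBlocks_multiply]
  simp only [Matrix.mul_one, Matrix.mul_smul, Matrix.mul_neg, smul_neg, neg_neg, sub_eq_add_neg]

/-- `½T₁′ · T = ½ (D − iC₀, D + iC₀; D + iC₀, D − iC₀)`. [cite: Shimura1997, §6.5] -/
theorem cayleyInv_mul_frame (D C₀ : Matrix l l ℂ) :
    ((2 : ℂ)⁻¹ • fromBlocks 1 (-(I • 1)) 1 (I • 1) : Matrix (l ⊕ l) (l ⊕ l) ℂ) * fromBlocks D D C₀ (-C₀) =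
      (2 : ℂ)⁻¹ • fromBlocks (D - I • C₀) (D + I • C₀) (D + I • C₀) (D - I • C₀) := by
  rw [Matrix.smul_mul, fromBlocks_multiply]
  simp only [Matrix.one_mul, Matrix.smul_mul, Matrix.mul_neg, Matrix.neg_mul, neg_neg, sub_eq_add_neg]

/-- **`T⁻¹ κ(k₁,k₂) T` in block letters**: `½ ((P₀−iP₁)k₁(D−iC₀) + (P₀+iP₁)k₂(D+iC₀), … ; …, …)`. [cite: Shimura1997, §6.5] [cite: KonnoKonno2007, §3.1] -/
theorem frameInv_kappa_frame_letters (D C₀ P₀ P₁ k₁ k₂ : Matrix l l ℂ) :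
    fromBlocks P₀ (-P₁) P₀ P₁ *
        ((fromBlocks 1 1 (I • 1) (-(I • 1)) : Matrix (l ⊕ l) (l ⊕ l) ℂ) * fromBlocks k₁ 0 0 k₂ * ((2 : ℂ)⁻¹ • fromBlocks 1 (-(I • 1)) 1 (I • 1))) *
        fromBlocks D D C₀ (-C₀) =
      (2 : ℂ)⁻¹ • fromBlocks
        ((P₀ - I • P₁) * k₁ * (D - I • C₀) + (P₀ + I • P₁) * k₂ * (D + I • C₀))
        ((P₀ - I • P₁) * k₁ * (D + I • C₀) + (P₀ + I • P₁) * k₂ * (D - I • C₀))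
        ((P₀ + I • P₁) * k₁ * (D - I • C₀) + (P₀ - I • P₁) * k₂ * (D + I • C₀))
        ((P₀ + I • P₁) * k₁ * (D + I • C₀) + (P₀ - I • P₁) * k₂ * (D - I • C₀)) := by
  rw [show fromBlocks P₀ (-P₁) P₀ P₁ * ((fromBlocks 1 1 (I • 1) (-(I • 1)) : Matrix (l ⊕ l) (l ⊕ l) ℂ) * fromBlocks k₁ 0 0 k₂ *
        ((2 : ℂ)⁻¹ • fromBlocks 1 (-(I • 1)) 1 (I • 1))) * fromBlocks D D C₀ (-C₀) =
      (fromBlocks P₀ (-P₁) P₀ P₁ * (fromBlocks 1 1 (I • 1) (-(I • 1)) : Matrix (l ⊕ l) (l ⊕ l) ℂ)) * fromBlocks k₁ 0 0 k₂ *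
        (((2 : ℂ)⁻¹ • fromBlocks 1 (-(I • 1)) 1 (I • 1) : Matrix (l ⊕ l) (l ⊕ l) ℂ) * fromBlocks D D C₀ (-C₀)) by simp only [Matrix.mul_assoc],
    frameInv_mul_cayley, cayleyInv_mul_frame, Matrix.mul_smul, fromBlocks_multiply, fromBlocks_multiply]
  simp only [Matrix.mul_zero, add_zero, zero_add]

/-! ## §2 The diagonal letters `P₀ ∓ iP₁`, `D ∓ iC₀`, and the signs `e_i = ±1` -/

section Letters

variable (d e : l → ℝ)
omit [Fintype l] in
/-- `P₀ − iP₁ = diag((1+e) d⁻¹∕2)`. [cite: Shimura1997, §6] -/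
theorem letters_P₀_sub_I_P₁ :
    diagonal (fun i => (((d i)⁻¹ / 2 : ℝ) : ℂ)) - I • diagonal (fun i => I * (((d i)⁻¹ * e i / 2 : ℝ) : ℂ)) =
      diagonal (fun i => (((1 + e i) * (d i)⁻¹ / 2 : ℝ) : ℂ)) := by
  rw [← diagonal_smul, diagonal_sub]
  refine congrArg diagonal (funext fun i => ?_)
  simp only [Pi.smul_apply, smul_eq_mul]
  have key : (((d i)⁻¹ / 2 : ℝ) : ℂ) - I * (I * (((d i)⁻¹ * e i / 2 : ℝ) : ℂ)) =
      (((d i)⁻¹ / 2 : ℝ) : ℂ) - (I * I) * (((d i)⁻¹ * e i / 2 : ℝ) : ℂ) := by ring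
  rw [key, I_mul_I]; push_cast; ring

omit [Fintype l] in
/-- `P₀ + iP₁ = diag((1−e) d⁻¹∕2)`. [cite: Shimura1997, §6] -/
theorem letters_P₀_add_I_P₁ :
    diagonal (fun i => (((d i)⁻¹ / 2 : ℝ) : ℂ)) + I • diagonal (fun i => I * (((d i)⁻¹ * e i / 2 : ℝ) : ℂ)) =
      diagonal (fun i => (((1 - e i) * (d i)⁻¹ / 2 : ℝ) : ℂ)) := by
  rw [← diagonal_smul, diagonal_add]
  refine congrArg diagonal (funext fun i => ?_)
  simp only [Pi.smul_apply, smul_eq_mul]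
  have key : (((d i)⁻¹ / 2 : ℝ) : ℂ) + I * (I * (((d i)⁻¹ * e i / 2 : ℝ) : ℂ)) =
      (((d i)⁻¹ / 2 : ℝ) : ℂ) + (I * I) * (((d i)⁻¹ * e i / 2 : ℝ) : ℂ) := by ring
  rw [key, I_mul_I]; push_cast; ring

omit [Fintype l] in
/-- `D − iC₀ = diag((1+e) d)`. [cite: Shimura1997, §6] -/
theorem letters_D_sub_I_C₀ :
    diagonal (fun i => (d i : ℂ)) - I • diagonal (fun i => I * ((e i * d i : ℝ) : ℂ)) = diagonal (fun i => (((1 + e i) * d i : ℝ) : ℂ)) := by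
  rw [← diagonal_smul, diagonal_sub]
  refine congrArg diagonal (funext fun i => ?_)
  simp only [Pi.smul_apply, smul_eq_mul]
  have key : (d i : ℂ) - I * (I * ((e i * d i : ℝ) : ℂ)) = (d i : ℂ) - (I * I) * ((e i * d i : ℝ) : ℂ) := by ring
  rw [key, I_mul_I]; push_cast; ring

omit [Fintype l] in
/-- `D + iC₀ = diag((1−e) d)`. [cite: Shimura1997, §6] -/
theorem letters_D_add_I_C₀ :
    diagonal (fun i => (d i : ℂ)) + I • diagonal (fun i => I * ((e i * d i : ℝ) : ℂ)) = diagonal (fun i => (((1 - e i) * d i : ℝ) : ℂ)) := by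
  rw [← diagonal_smul, diagonal_add]
  refine congrArg diagonal (funext fun i => ?_)
  simp only [Pi.smul_apply, smul_eq_mul]
  have key : (d i : ℂ) + I * (I * ((e i * d i : ℝ) : ℂ)) = (d i : ℂ) + (I * I) * ((e i * d i : ℝ) : ℂ) := by ring
  rw [key, I_mul_I]; push_cast; ring

omit [Fintype l] [DecidableEq l] in
/-- `e_i = t_i∕|t_i| = 1` when `0 < t_i`. [folklore] -/
theorem sign_letter_of_pos {t : l → ℝ} {i : l} (h : 0 < t i) : t i / |t i| = 1 := by
  rw [abs_of_pos h, div_self h.ne']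

omit [Fintype l] [DecidableEq l] in
/-- `e_i = t_i∕|t_i| = −1` when `t_i ≠ 0` is not positive. [folklore] -/
theorem sign_letter_of_not_pos {t : l → ℝ} {i : l} (h0 : t i ≠ 0) (h : ¬0 < t i) : t i / |t i| = -1 := by
  have hneg : t i < 0 := lt_of_le_of_ne (not_lt.1 h) h0
  rw [abs_of_neg hneg, div_neg, div_self h0]

/-- an entry of `diag(a) · k · diag(b)`. [folklore] -/
theorem diagonal_mul_mul_diagonal_apply (a b : l → ℂ) (k : Matrix l l ℂ) (i j : l) :
    (diagonal a * k * diagonal b) i j = a i * k i j * b j := by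
  rw [mul_diagonal, diagonal_mul]

end Letters

/-! ## §3 The sign-sorted form of `T⁻¹ κ(k₁,k₂) T` -/

section Sorted
omit [Fintype l] [DecidableEq l] in
/-- entry bookkeeping, block `₁₁`: `(d_j∕d_i)·[x if t_i,t_j > 0; y if t_i,t_j < 0; 0 else]`. [folklore] -/
theorem entry_sorted₁₁ (t : l → ℝ) (ht : ∀ i, t i ≠ 0) (x y : ℂ) (i j : l) :
    (2 : ℂ)⁻¹ * ((((1 + t i / |t i|) * (Real.sqrt (|t i| / 2))⁻¹ / 2 : ℝ) : ℂ) * x * (((1 + t j / |t j|) * Real.sqrt (|t j| / 2) : ℝ) : ℂ) +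
        (((1 - t i / |t i|) * (Real.sqrt (|t i| / 2))⁻¹ / 2 : ℝ) : ℂ) * y * (((1 - t j / |t j|) * Real.sqrt (|t j| / 2) : ℝ) : ℂ)) =
      ((Real.sqrt (|t j| / 2) / Real.sqrt (|t i| / 2) : ℝ) : ℂ) * (if 0 < t i then (if 0 < t j then x else 0) else (if 0 < t j then 0 else y)) := by
  by_cases hi : 0 < t i <;> by_cases hj : 0 < t j
  · rw [sign_letter_of_pos hi, sign_letter_of_pos hj, if_pos hi, if_pos hj]; push_cast; ring
  · rw [sign_letter_of_pos hi, sign_letter_of_not_pos (ht j) hj, if_pos hi, if_neg hj]; push_cast; ring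
  · rw [sign_letter_of_not_pos (ht i) hi, sign_letter_of_pos hj, if_neg hi, if_pos hj]; push_cast; ring
  · rw [sign_letter_of_not_pos (ht i) hi, sign_letter_of_not_pos (ht j) hj, if_neg hi, if_neg hj]; push_cast; ring

omit [Fintype l] [DecidableEq l] in
/-- entry bookkeeping, block `₁₂`: `(d_j∕d_i)·[x if t_i > 0 > t_j; y if t_i < 0 < t_j; 0 else]`. [folklore] -/
theorem entry_sorted₁₂ (t : l → ℝ) (ht : ∀ i, t i ≠ 0) (x y : ℂ) (i j : l) :
    (2 : ℂ)⁻¹ * ((((1 + t i / |t i|) * (Real.sqrt (|t i| / 2))⁻¹ / 2 : ℝ) : ℂ) * x * (((1 - t j / |t j|) * Real.sqrt (|t j| / 2) : ℝ) : ℂ) +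
        (((1 - t i / |t i|) * (Real.sqrt (|t i| / 2))⁻¹ / 2 : ℝ) : ℂ) * y * (((1 + t j / |t j|) * Real.sqrt (|t j| / 2) : ℝ) : ℂ)) =
      ((Real.sqrt (|t j| / 2) / Real.sqrt (|t i| / 2) : ℝ) : ℂ) * (if 0 < t i then (if 0 < t j then 0 else x) else (if 0 < t j then y else 0)) := by
  by_cases hi : 0 < t i <;> by_cases hj : 0 < t j
  · rw [sign_letter_of_pos hi, sign_letter_of_pos hj, if_pos hi, if_pos hj]; push_cast; ring
  · rw [sign_letter_of_pos hi, sign_letter_of_not_pos (ht j) hj, if_pos hi, if_neg hj]; push_cast; ring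
  · rw [sign_letter_of_not_pos (ht i) hi, sign_letter_of_pos hj, if_neg hi, if_pos hj]; push_cast; ring
  · rw [sign_letter_of_not_pos (ht i) hi, sign_letter_of_not_pos (ht j) hj, if_neg hi, if_neg hj]; push_cast; ring

omit [Fintype l] [DecidableEq l] in
/-- entry bookkeeping, block `₂₁`: `½((1−e_i)d_i⁻¹∕2·x·(1+e_j)d_j + (1+e_i)d_i⁻¹∕2·y·(1−e_j)d_j) = (d_j∕d_i)·[y if t_i > 0 > t_j; x if t_i < 0 < t_j; 0 else]`. [folklore] -/
theorem entry_sorted₂₁ (t : l → ℝ) (ht : ∀ i, t i ≠ 0) (x y : ℂ) (i j : l) :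
    (2 : ℂ)⁻¹ * ((((1 - t i / |t i|) * (Real.sqrt (|t i| / 2))⁻¹ / 2 : ℝ) : ℂ) * x * (((1 + t j / |t j|) * Real.sqrt (|t j| / 2) : ℝ) : ℂ) +
        (((1 + t i / |t i|) * (Real.sqrt (|t i| / 2))⁻¹ / 2 : ℝ) : ℂ) * y * (((1 - t j / |t j|) * Real.sqrt (|t j| / 2) : ℝ) : ℂ)) =
      ((Real.sqrt (|t j| / 2) / Real.sqrt (|t i| / 2) : ℝ) : ℂ) * (if 0 < t i then (if 0 < t j then 0 else y) else (if 0 < t j then x else 0)) := by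
  by_cases hi : 0 < t i <;> by_cases hj : 0 < t j
  · rw [sign_letter_of_pos hi, sign_letter_of_pos hj, if_pos hi, if_pos hj]; push_cast; ring
  · rw [sign_letter_of_pos hi, sign_letter_of_not_pos (ht j) hj, if_pos hi, if_neg hj]; push_cast; ring
  · rw [sign_letter_of_not_pos (ht i) hi, sign_letter_of_pos hj, if_neg hi, if_pos hj]; push_cast; ring
  · rw [sign_letter_of_not_pos (ht i) hi, sign_letter_of_not_pos (ht j) hj, if_neg hi, if_neg hj]; push_cast; ring

omit [Fintype l] [DecidableEq l] in
/-- entry bookkeeping, block `₂₂`: `½((1−e_i)d_i⁻¹∕2·x·(1−e_j)d_j + (1+e_i)d_i⁻¹∕2·y·(1+e_j)d_j) = (d_j∕d_i)·[y if t_i,t_j > 0; x if t_i,t_j < 0; 0 else]`. [folklore] -/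
theorem entry_sorted₂₂ (t : l → ℝ) (ht : ∀ i, t i ≠ 0) (x y : ℂ) (i j : l) :
    (2 : ℂ)⁻¹ * ((((1 - t i / |t i|) * (Real.sqrt (|t i| / 2))⁻¹ / 2 : ℝ) : ℂ) * x * (((1 - t j / |t j|) * Real.sqrt (|t j| / 2) : ℝ) : ℂ) +
        (((1 + t i / |t i|) * (Real.sqrt (|t i| / 2))⁻¹ / 2 : ℝ) : ℂ) * y * (((1 + t j / |t j|) * Real.sqrt (|t j| / 2) : ℝ) : ℂ)) =
      ((Real.sqrt (|t j| / 2) / Real.sqrt (|t i| / 2) : ℝ) : ℂ) * (if 0 < t i then (if 0 < t j then y else 0) else (if 0 < t j then 0 else x)) := by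
  by_cases hi : 0 < t i <;> by_cases hj : 0 < t j
  · rw [sign_letter_of_pos hi, sign_letter_of_pos hj, if_pos hi, if_pos hj]; push_cast; ring
  · rw [sign_letter_of_pos hi, sign_letter_of_not_pos (ht j) hj, if_pos hi, if_neg hj]; push_cast; ring
  · rw [sign_letter_of_not_pos (ht i) hi, sign_letter_of_pos hj, if_neg hi, if_pos hj]; push_cast; ring
  · rw [sign_letter_of_not_pos (ht i) hi, sign_letter_of_not_pos (ht j) hj, if_neg hi, if_neg hj]; push_cast; ring

/-- **THE SIGN-SORTED FORM OF `T⁻¹ κ(k₁,k₂) T`** for the Shimura letters of `t` (★ `K2LiuHermitianTubeFrame` §3): entry `(d_j∕d_i)·(k₁)_{ij}` when the row index and the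
column index both lie in the slot `{inl i : 0 < t_i} ∪ {inr i : t_i < 0}`, `(d_j∕d_i)·(k₂)_{ij}` when both lie in the complementary slot, `0` across the slots.
[cite: Shimura1997, §6.5] [cite: KonnoKonno2007, §3.1] [cite: Folland1989, §4.2 Prop. (4.39)] -/
theorem frameInv_kappa_frame (t : l → ℝ) (ht : ∀ i, t i ≠ 0) (k₁ k₂ : Matrix l l ℂ) :
    fromBlocks (diagonal (fun i => (((Real.sqrt (|t i| / 2))⁻¹ / 2 : ℝ) : ℂ))) (-diagonal (fun i => I * (((Real.sqrt (|t i| / 2))⁻¹ * (t i / |t i|) / 2 : ℝ) : ℂ)))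
        (diagonal (fun i => (((Real.sqrt (|t i| / 2))⁻¹ / 2 : ℝ) : ℂ))) (diagonal (fun i => I * (((Real.sqrt (|t i| / 2))⁻¹ * (t i / |t i|) / 2 : ℝ) : ℂ))) *
        ((fromBlocks 1 1 (I • 1) (-(I • 1)) : Matrix (l ⊕ l) (l ⊕ l) ℂ) * fromBlocks k₁ 0 0 k₂ * ((2 : ℂ)⁻¹ • fromBlocks 1 (-(I • 1)) 1 (I • 1))) *
        fromBlocks (diagonal (fun i => (Real.sqrt (|t i| / 2) : ℂ))) (diagonal (fun i => (Real.sqrt (|t i| / 2) : ℂ)))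
          (diagonal (fun i => I * (((t i / |t i|) * Real.sqrt (|t i| / 2) : ℝ) : ℂ))) (-diagonal (fun i => I * (((t i / |t i|) * Real.sqrt (|t i| / 2) : ℝ) : ℂ))) =
      fromBlocks
        (Matrix.of fun i j => ((Real.sqrt (|t j| / 2) / Real.sqrt (|t i| / 2) : ℝ) : ℂ) *
          (if 0 < t i then (if 0 < t j then k₁ i j else 0) else (if 0 < t j then 0 else k₂ i j)))
        (Matrix.of fun i j => ((Real.sqrt (|t j| / 2) / Real.sqrt (|t i| / 2) : ℝ) : ℂ) *
          (if 0 < t i then (if 0 < t j then 0 else k₁ i j) else (if 0 < t j then k₂ i j else 0)))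
        (Matrix.of fun i j => ((Real.sqrt (|t j| / 2) / Real.sqrt (|t i| / 2) : ℝ) : ℂ) *
          (if 0 < t i then (if 0 < t j then 0 else k₂ i j) else (if 0 < t j then k₁ i j else 0)))
        (Matrix.of fun i j => ((Real.sqrt (|t j| / 2) / Real.sqrt (|t i| / 2) : ℝ) : ℂ) *
          (if 0 < t i then (if 0 < t j then k₂ i j else 0) else (if 0 < t j then 0 else k₁ i j))) := by
  rw [frameInv_kappa_frame_letters, letters_P₀_sub_I_P₁, letters_P₀_add_I_P₁, letters_D_sub_I_C₀, letters_D_add_I_C₀, fromBlocks_smul,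
    fromBlocks_inj]
  refine ⟨?_, ?_, ?_, ?_⟩ <;> ext i j <;>
    simp only [Matrix.smul_apply, Matrix.add_apply, diagonal_mul_mul_diagonal_apply, Matrix.of_apply, smul_eq_mul]
  · exact entry_sorted₁₁ t ht (k₁ i j) (k₂ i j) i j
  · exact entry_sorted₁₂ t ht (k₁ i j) (k₂ i j) i j
  · exact entry_sorted₂₁ t ht (k₁ i j) (k₂ i j) i j
  · exact entry_sorted₂₂ t ht (k₁ i j) (k₂ i j) i j

end Sorted
/-! ## §4 `Tᴴ T = |H|`: the frame is adapted to the majorant -/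

/-- **`Tᴴ T = diag|t| ⊕ diag|t|`** for the Shimura letters (`D̄D − C̄₀… `: `d² + (e d)² = 2d² = |t|`, off-diagonal blocks `d² − e²d² = 0`): the frame carries the unitary group of the
majorant `|H| = diag|t| ⊕ diag|t|` — the SIGN-FRAME maximal compact of `U(H)` — onto `U(2l) ∩ U(J) = Stab(i1)`. [cite: Shimura1997, §6.5] [cite: Folland1989, §4.2 Prop. (4.39)] -/
theorem frame_conjTranspose_mul_frame (t : l → ℝ) (ht : ∀ i, t i ≠ 0) :
    (fromBlocks (diagonal (fun i => (Real.sqrt (|t i| / 2) : ℂ))) (diagonal (fun i => (Real.sqrt (|t i| / 2) : ℂ)))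
        (diagonal (fun i => I * (((t i / |t i|) * Real.sqrt (|t i| / 2) : ℝ) : ℂ))) (-diagonal (fun i => I * (((t i / |t i|) * Real.sqrt (|t i| / 2) : ℝ) : ℂ))))ᴴ *
      fromBlocks (diagonal (fun i => (Real.sqrt (|t i| / 2) : ℂ))) (diagonal (fun i => (Real.sqrt (|t i| / 2) : ℂ)))
        (diagonal (fun i => I * (((t i / |t i|) * Real.sqrt (|t i| / 2) : ℝ) : ℂ))) (-diagonal (fun i => I * (((t i / |t i|) * Real.sqrt (|t i| / 2) : ℝ) : ℂ))) =
      fromBlocks (diagonal fun i => ((|t i| : ℝ) : ℂ)) 0 0 (diagonal fun i => ((|t i| : ℝ) : ℂ)) := by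
  -- `Dᴴ = D`, `C₀ᴴ = −C₀`
  have hDH : (diagonal (fun i => (Real.sqrt (|t i| / 2) : ℂ)))ᴴ = diagonal (fun i => (Real.sqrt (|t i| / 2) : ℂ)) := by
    rw [diagonal_conjTranspose]
    exact congrArg diagonal (funext fun i => conj_ofReal _)
  have hCH : (diagonal (fun i => I * (((t i / |t i|) * Real.sqrt (|t i| / 2) : ℝ) : ℂ)))ᴴ =
      -diagonal (fun i => I * (((t i / |t i|) * Real.sqrt (|t i| / 2) : ℝ) : ℂ)) := by
    rw [diagonal_conjTranspose, diagonal_neg]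
    refine congrArg diagonal (funext fun i => ?_)
    simp only [Pi.star_apply, RCLike.star_def, map_mul, conj_I, conj_ofReal, neg_mul]
  have hs : ∀ i, ((Real.sqrt (|t i| / 2) : ℝ) : ℂ) * ((Real.sqrt (|t i| / 2) : ℝ) : ℂ) = (((|t i| / 2 : ℝ)) : ℂ) := by
    intro i; rw [← ofReal_mul, Real.mul_self_sqrt (by positivity)]
  have he : ∀ i, ((t i / |t i| : ℝ) : ℂ) * ((t i / |t i| : ℝ) : ℂ) = 1 := by
    intro i; rw [← ofReal_mul, (letters_of t ht i).2.1, ofReal_one]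
  have hDD : diagonal (fun i => (Real.sqrt (|t i| / 2) : ℂ)) * diagonal (fun i => (Real.sqrt (|t i| / 2) : ℂ)) =
      diagonal (fun i => ((|t i| / 2 : ℝ) : ℂ)) := by
    rw [diagonal_mul_diagonal]
    exact congrArg diagonal (funext fun i => hs i)
  have hCC : diagonal (fun i => I * (((t i / |t i|) * Real.sqrt (|t i| / 2) : ℝ) : ℂ)) * diagonal (fun i => I * (((t i / |t i|) * Real.sqrt (|t i| / 2) : ℝ) : ℂ)) =
      -diagonal (fun i => ((|t i| / 2 : ℝ) : ℂ)) := by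
    rw [diagonal_mul_diagonal, diagonal_neg]
    refine congrArg diagonal (funext fun i => ?_)
    have key : I * (((t i / |t i|) * Real.sqrt (|t i| / 2) : ℝ) : ℂ) * (I * (((t i / |t i|) * Real.sqrt (|t i| / 2) : ℝ) : ℂ)) =
        (I * I) * (((t i / |t i| : ℝ) : ℂ) * ((t i / |t i| : ℝ) : ℂ)) * (((Real.sqrt (|t i| / 2) : ℝ) : ℂ) * ((Real.sqrt (|t i| / 2) : ℝ) : ℂ)) := by
      push_cast; ring
    rw [key, I_mul_I, he, hs]; ring
  have h2 : diagonal (fun i => ((|t i| / 2 : ℝ) : ℂ)) + diagonal (fun i => ((|t i| / 2 : ℝ) : ℂ)) = diagonal (fun i => ((|t i| : ℝ) : ℂ)) := by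
    rw [diagonal_add]
    refine congrArg diagonal (funext fun i => ?_)
    push_cast; ring
  rw [fromBlocks_conjTranspose, conjTranspose_neg, hDH, hCH, neg_neg, fromBlocks_multiply, fromBlocks_inj]
  simp only [Matrix.neg_mul, Matrix.mul_neg, neg_neg, hDD, hCC, ← sub_eq_add_neg, sub_self, h2, and_self]


/-! ## §5 The packages with the EXPLICIT frame: ring level and per complex place -/

section Ring

/-- **THE RING-LEVEL FRAME PACKAGE WITH THE FRAME MADE EXPLICIT**: every conjunct of ★ `exists_tubeFrame₃` (i)–(vii) for ONE frame `(T, T⁻¹)` PLUS (x) the Shimura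
letters themselves, `T = (D D; C₀ −C₀)`, `T⁻¹ = (P₀ −P₁; P₀ P₁)` — so that §3 (`frameInv_kappa_frame`, the sign-sorted `T⁻¹ κ T`) and §4 (`Tᴴ T = |H|`) and any
later letter about the explicit frame apply to the packaged `T` by `subst`. [cite: Shimura1997, §§5–6] -/
theorem exists_tubeFrame₄ (t : l → ℝ) (ht : ∀ i, t i ≠ 0) :
    ∃ T Tinv : Matrix (l ⊕ l) (l ⊕ l) ℂ, T * Tinv = 1 ∧ Tinv * T = 1 ∧
      Tᴴ * (I • Matrix.J l ℂ) * T = fromBlocks (diagonal fun i => (t i : ℂ)) 0 0 (-diagonal fun i => (t i : ℂ)) ∧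
      (∀ g : Matrix (l ⊕ l) (l ⊕ l) ℂ, g.toBlocks₁₁ + g.toBlocks₁₂ = g.toBlocks₂₁ + g.toBlocks₂₂ →
        (T * g * Tinv).toBlocks₂₁ = 0) ∧
      (∀ φ : Matrix l l ℂ, ∃ b : Matrix l l ℂ, T * fromBlocks (1 + φ) (-φ) φ (1 - φ) * Tinv = fromBlocks 1 b 0 1 ∧
        ((diagonal (fun i => (t i : ℂ)) * φ)ᴴ = -(diagonal (fun i => (t i : ℂ)) * φ) → bᴴ = b)) ∧
      (∀ b : Matrix l l ℂ, bᴴ = b → ∃ φ : Matrix l l ℂ, (diagonal (fun i => (t i : ℂ)) * φ)ᴴ = -(diagonal (fun i => (t i : ℂ)) * φ) ∧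
        T * fromBlocks (1 + φ) (-φ) φ (1 - φ) * Tinv = fromBlocks 1 b 0 1) ∧
      (∃ B C : Matrix l l ℂ, IsUnit C.det ∧ T * fromBlocks 1 0 0 (-1) * Tinv = fromBlocks 0 B C 0) ∧
      T = fromBlocks (diagonal (fun i => (Real.sqrt (|t i| / 2) : ℂ))) (diagonal (fun i => (Real.sqrt (|t i| / 2) : ℂ)))
          (diagonal (fun i => I * (((t i / |t i|) * Real.sqrt (|t i| / 2) : ℝ) : ℂ))) (-diagonal (fun i => I * (((t i / |t i|) * Real.sqrt (|t i| / 2) : ℝ) : ℂ))) ∧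
      Tinv = fromBlocks (diagonal (fun i => (((Real.sqrt (|t i| / 2))⁻¹ / 2 : ℝ) : ℂ))) (-diagonal (fun i => I * (((Real.sqrt (|t i| / 2))⁻¹ * (t i / |t i|) / 2 : ℝ) : ℂ)))
          (diagonal (fun i => (((Real.sqrt (|t i| / 2))⁻¹ / 2 : ℝ) : ℂ))) (diagonal (fun i => I * (((Real.sqrt (|t i| / 2))⁻¹ * (t i / |t i|) / 2 : ℝ) : ℂ))) := by
  -- the letters (as in ★ `exists_tubeFrame₃`)
  have hd : ∀ i, Real.sqrt (|t i| / 2) ≠ 0 := fun i => (letters_of t ht i).1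
  have he : ∀ i, t i / |t i| * (t i / |t i|) = 1 := fun i => (letters_of t ht i).2.1
  have ht' : ∀ i, 2 * (t i / |t i|) * Real.sqrt (|t i| / 2) * Real.sqrt (|t i| / 2) = t i := fun i => (letters_of t ht i).2.2
  have R1 := letters_R1 (fun i => Real.sqrt (|t i| / 2)) hd
  have R2 := letters_R2 (fun i => Real.sqrt (|t i| / 2)) (fun i => t i / |t i|) hd he
  have R3 := letters_R3 (fun i => Real.sqrt (|t i| / 2)) (fun i => t i / |t i|) hd he
  have R4 := letters_R4 (fun i => Real.sqrt (|t i| / 2)) (fun i => t i / |t i|) hd he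
  refine ⟨_, _, frame_mul_frameInv R1 R2, frameInv_mul_frame R3 R4,
    frame_conjTranspose_mul_smul_J_mul _ _ t ht', fun g hg => toBlocks₂₁_conj_eq_zero_of_siegel _ _ _ _ hg,
    fun φ => ⟨_, conj_unip_eq_transl R1 R2 φ, fun hφ => ?_⟩, fun b hb => ⟨_, skew_phi_of_transl _ _ hd he t ht' hb, ?_⟩,
    ⟨_, _, isUnit_det_weylBlock R1 R2, frame_mul_blockDiag_mul_frameInv _ _ _ _⟩, rfl, rfl⟩
  · have h := conjTranspose_transl_of_skew (fun i => Real.sqrt (|t i| / 2)) (fun i => t i / |t i|) hd he t ht' hφ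
    simp only [conjTranspose_neg, conjTranspose_add, h]
  · rw [conj_unip_eq_transl R1 R2, frame_phi_of_transl _ _ hd he]
    congr 1
    rw [← add_smul, ← add_smul, ← neg_smul]
    norm_num

end Ring

section Arch
open NumberField
open Literature.NumberTheory.Automorphic Literature.NumberTheory.Automorphic.UnitaryGroup
open Literature.NumberTheory.GelbartRogawski1991 Literature.NumberTheory.GelbartRogawski1991.GRConstruction
open K2LiuHermitianTubeFrameArch K2LiuHermitianTubeFrameArchInv K2LiuSiegelUnipotentLocalDefs

variable (L : Type) [Field L] [NumberField L] [IsCMField L] {N M n : ℕ} (e : Fin N × Fin M ≃ Fin n)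
  (dV : Fin N → L) (hdV : ∀ i, IsCMField.complexConj L (dV i) = dV i)
  (dW : Fin M → L) (hdW : ∀ i, IsCMField.complexConj L (dW i) = dW i)
  (w : {w : InfinitePlace L // w.IsComplex})

/-- **THE PER-PLACE FRAME PACKAGE WITH THE FRAME MADE EXPLICIT** at the complex place `w` of the CM field (`t_w k = Re σ_w(dV_{(e⁻¹k).1} dW_{(e⁻¹k).2})`):
every conjunct of ★ `exists_tubeFrame_arch₃` (i)–(vii) for ONE frame `(T, T⁻¹)` PLUS (x) `T, T⁻¹` = the Shimura letters of `t_w` — so that the packaging reads, by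
`subst`, §3 `frameInv_kappa_frame` (sign-sorted `T⁻¹ κ(k₁,k₂) T`: the reading points `ι_w κ(1, v)` have SIGN-SEPARATED place components) and §4 `Tᴴ T = |H_w|` off the SAME
frame that carries (law)∕(der). [cite: Shimura1997, §§5–6] [cite: KonnoKonno2007, §3.1] -/
theorem exists_tubeFrame_arch₄ (hw : IsCMField.complexConj L • w.1 = w.1) (hdV0 : ∀ i, dV i ≠ 0) (hdW0 : ∀ j, dW j ≠ 0) :
    ∃ T Tinv : Matrix (Fin n ⊕ Fin n) (Fin n ⊕ Fin n) ℂ, T * Tinv = 1 ∧ Tinv * T = 1 ∧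
      (∀ g : GL (Fin (n + n)) ℂ, g ∈ archLocal L (n + n) (hermD L e dV hdV dW hdW) w →
        (T * Matrix.reindex (e₂ (n := n)).symm (e₂ (n := n)).symm (g : Matrix _ _ ℂ) * Tinv)ᴴ * Matrix.J (Fin n) ℂ *
          (T * Matrix.reindex (e₂ (n := n)).symm (e₂ (n := n)).symm (g : Matrix _ _ ℂ) * Tinv) = Matrix.J (Fin n) ℂ) ∧
      (∀ g : GL (Fin (n + n)) ℂ, IsSiegelM (n := n) (g : Matrix (Fin (n + n)) (Fin (n + n)) ℂ) →
        (T * Matrix.reindex (e₂ (n := n)).symm (e₂ (n := n)).symm (g : Matrix _ _ ℂ) * Tinv).toBlocks₂₁ = 0) ∧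
      (∀ u : GL (Fin (n + n)) ℂ, u ∈ archLocal L (n + n) (hermD L e dV hdV dW hdW) w → IsUnipM (n := n) (u : Matrix (Fin (n + n)) (Fin (n + n)) ℂ) →
        ∃ b : Matrix (Fin n) (Fin n) ℂ, bᴴ = b ∧
          T * Matrix.reindex (e₂ (n := n)).symm (e₂ (n := n)).symm (u : Matrix _ _ ℂ) * Tinv = fromBlocks 1 b 0 1) ∧
      (∀ b : Matrix (Fin n) (Fin n) ℂ, bᴴ = b → ∃ u : GL (Fin (n + n)) ℂ,
        u ∈ archLocal L (n + n) (hermD L e dV hdV dW hdW) w ∧ IsUnipM (n := n) (u : Matrix (Fin (n + n)) (Fin (n + n)) ℂ) ∧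
          T * Matrix.reindex (e₂ (n := n)).symm (e₂ (n := n)).symm (u : Matrix _ _ ℂ) * Tinv = fromBlocks 1 b 0 1) ∧
      (∀ P : Matrix (Fin n ⊕ Fin n) (Fin n ⊕ Fin n) ℂ, Pᴴ * Matrix.J (Fin n) ℂ * P = Matrix.J (Fin n) ℂ →
        ∃ g : GL (Fin (n + n)) ℂ, g ∈ archLocal L (n + n) (hermD L e dV hdV dW hdW) w ∧
          T * Matrix.reindex (e₂ (n := n)).symm (e₂ (n := n)).symm (g : Matrix _ _ ℂ) * Tinv = P) ∧
      (∃ B C : Matrix (Fin n) (Fin n) ℂ, IsUnit C.det ∧ T * fromBlocks 1 0 0 (-1) * Tinv = fromBlocks 0 B C 0) ∧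
      T = fromBlocks (diagonal (fun k => (Real.sqrt (|(w.1.embedding (dV (e.symm k).1 * dW (e.symm k).2)).re| / 2) : ℂ))) (diagonal (fun k => (Real.sqrt (|(w.1.embedding (dV (e.symm k).1 * dW (e.symm k).2)).re| / 2) : ℂ)))
          (diagonal (fun k => I * ((((w.1.embedding (dV (e.symm k).1 * dW (e.symm k).2)).re / |(w.1.embedding (dV (e.symm k).1 * dW (e.symm k).2)).re|) * Real.sqrt (|(w.1.embedding (dV (e.symm k).1 * dW (e.symm k).2)).re| / 2) : ℝ) : ℂ))) (-diagonal (fun k => I * ((((w.1.embedding (dV (e.symm k).1 * dW (e.symm k).2)).re / |(w.1.embedding (dV (e.symm k).1 * dW (e.symm k).2)).re|) * Real.sqrt (|(w.1.embedding (dV (e.symm k).1 * dW (e.symm k).2)).re| / 2) : ℝ) : ℂ))) ∧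
      Tinv = fromBlocks (diagonal (fun k => (((Real.sqrt (|(w.1.embedding (dV (e.symm k).1 * dW (e.symm k).2)).re| / 2))⁻¹ / 2 : ℝ) : ℂ))) (-diagonal (fun k => I * (((Real.sqrt (|(w.1.embedding (dV (e.symm k).1 * dW (e.symm k).2)).re| / 2))⁻¹ * ((w.1.embedding (dV (e.symm k).1 * dW (e.symm k).2)).re / |(w.1.embedding (dV (e.symm k).1 * dW (e.symm k).2)).re|) / 2 : ℝ) : ℂ)))
          (diagonal (fun k => (((Real.sqrt (|(w.1.embedding (dV (e.symm k).1 * dW (e.symm k).2)).re| / 2))⁻¹ / 2 : ℝ) : ℂ))) (diagonal (fun k => I * (((Real.sqrt (|(w.1.embedding (dV (e.symm k).1 * dW (e.symm k).2)).re| / 2))⁻¹ * ((w.1.embedding (dV (e.symm k).1 * dW (e.symm k).2)).re / |(w.1.embedding (dV (e.symm k).1 * dW (e.symm k).2)).re|) / 2 : ℝ) : ℂ))) := by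
  obtain ⟨T, Tinv, h1, h2, hT, hS, hU, hB, hW, hTdef, hTinvdef⟩ :=
    exists_tubeFrame₄ (fun k => (w.1.embedding (dV (e.symm k).1 * dW (e.symm k).2)).re) (tw_ne_zero L e dV hdV dW hdW w hw hdV0 hdW0)
  refine ⟨T, Tinv, h1, h2, fun g hg => ?_, fun g hg => hS _ hg, fun u hu hU' => ?_, fun b hb => ?_, fun P hP => ?_, hW, hTdef, hTinvdef⟩
  · exact conj_mem_UJ hT h1 ((mem_archLocal_hermD_iff L e dV hdV dW hdW w hw g).1 hg)
  · have hshape := (isUnip_blocks_iff _).1 hU'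
    set φ := (Matrix.reindex (e₂ (n := n)).symm (e₂ (n := n)).symm (u : Matrix _ _ ℂ)).toBlocks₂₁
    obtain ⟨b, hb, hherm⟩ := hU φ
    refine ⟨b, hherm ?_, by rw [hshape]; exact hb⟩
    have hmem := (mem_archLocal_hermD_iff L e dV hdV dW hdW w hw u).1 hu
    rw [hshape] at hmem
    exact (unip_conjTranspose_mul_form_mul_iff (by rw [diagonal_conjTranspose]; simp [Pi.star_def]) φ).1 hmem
  · obtain ⟨φ, hskew, hφ⟩ := hB b hb
    have hunit : (fromBlocks (1 + φ) (-φ) φ (1 - φ))ᴴ *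
        fromBlocks (diagonal fun k => (((w.1.embedding (dV (e.symm k).1 * dW (e.symm k).2)).re : ℝ) : ℂ)) 0 0
          (-diagonal fun k => (((w.1.embedding (dV (e.symm k).1 * dW (e.symm k).2)).re : ℝ) : ℂ)) *
        fromBlocks (1 + φ) (-φ) φ (1 - φ) = _ :=
      (unip_conjTranspose_mul_form_mul_iff (by rw [diagonal_conjTranspose]; simp [Pi.star_def]) φ).2 hskew
    let U : Matrix (Fin (n + n)) (Fin (n + n)) ℂ := Matrix.reindex (e₂ (n := n)) (e₂ (n := n)) (fromBlocks (1 + φ) (-φ) φ (1 - φ))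
    let Uinv : Matrix (Fin (n + n)) (Fin (n + n)) ℂ :=
      Matrix.reindex (e₂ (n := n)) (e₂ (n := n)) (fromBlocks (1 - φ) φ (-φ) (1 + φ))
    have hUU : U * Uinv = 1 := by
      show Matrix.reindex _ _ _ * Matrix.reindex _ _ _ = 1
      rw [reindex_apply, reindex_apply, submatrix_mul_equiv, unip_mul_unip_neg, submatrix_one_equiv]
    have hUU' : Uinv * U = 1 := by
      show Matrix.reindex _ _ _ * Matrix.reindex _ _ _ = 1
      rw [reindex_apply, reindex_apply, submatrix_mul_equiv, unip_neg_mul_unip, submatrix_one_equiv]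
    refine ⟨⟨U, Uinv, hUU, hUU'⟩, ?_, isUnipM_reindex_unip φ, ?_⟩
    · rw [mem_archLocal_hermD_iff L e dV hdV dW hdW w hw]
      show (Matrix.reindex _ _ U)ᴴ * _ * Matrix.reindex _ _ U = _
      simp only [U, reindex_symm_reindex]
      exact hunit
    · show T * Matrix.reindex _ _ U * Tinv = _
      simp only [U, reindex_symm_reindex]
      exact hφ
  · -- surjectivity: `g̃ = Tinv P T`, inverse `Tinv (−J Pᴴ J) T` (as in ★ `exists_tubeFrame_arch₂`)
    let G : Matrix (Fin (n + n)) (Fin (n + n)) ℂ := Matrix.reindex (e₂ (n := n)) (e₂ (n := n)) (Tinv * P * T)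
    let Ginv : Matrix (Fin (n + n)) (Fin (n + n)) ℂ :=
      Matrix.reindex (e₂ (n := n)) (e₂ (n := n)) (Tinv * -(Matrix.J (Fin n) ℂ * Pᴴ * Matrix.J (Fin n) ℂ) * T)
    have hGG : G * Ginv = 1 := by
      show Matrix.reindex _ _ _ * Matrix.reindex _ _ _ = 1
      rw [reindex_apply, reindex_apply, submatrix_mul_equiv, show Tinv * P * T * (Tinv * -(Matrix.J (Fin n) ℂ * Pᴴ * Matrix.J (Fin n) ℂ) * T) =
        Tinv * (P * ((T * Tinv) * -(Matrix.J (Fin n) ℂ * Pᴴ * Matrix.J (Fin n) ℂ))) * T by simp only [Matrix.mul_assoc], h1, Matrix.one_mul,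
        mul_neg_J_conjTranspose_J hP, Matrix.mul_one, h2, submatrix_one_equiv]
    have hGG' : Ginv * G = 1 := by
      show Matrix.reindex _ _ _ * Matrix.reindex _ _ _ = 1
      rw [reindex_apply, reindex_apply, submatrix_mul_equiv, show Tinv * -(Matrix.J (Fin n) ℂ * Pᴴ * Matrix.J (Fin n) ℂ) * T * (Tinv * P * T) =
        Tinv * (-(Matrix.J (Fin n) ℂ * Pᴴ * Matrix.J (Fin n) ℂ) * ((T * Tinv) * P)) * T by simp only [Matrix.mul_assoc], h1, Matrix.one_mul,
        neg_J_conjTranspose_J_mul hP, Matrix.mul_one, h2, submatrix_one_equiv]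
    refine ⟨⟨G, Ginv, hGG, hGG'⟩, ?_, ?_⟩
    · rw [mem_archLocal_hermD_iff L e dV hdV dW hdW w hw]
      show (Matrix.reindex _ _ G)ᴴ * _ * Matrix.reindex _ _ G = _
      simp only [G, reindex_symm_reindex]
      exact inv_conj_preserves hT h1 h2 hP
    · show T * Matrix.reindex _ _ G * Tinv = P
      simp only [G, reindex_symm_reindex]
      rw [show T * (Tinv * P * T) * Tinv = (T * Tinv) * P * (T * Tinv) by simp only [Matrix.mul_assoc], h1, Matrix.one_mul,
        Matrix.mul_one]

end Arch

end Summit.HodgeConjecture.HodgeConjecture.Cruxes.HLiu418.K2LiuHermitianTubeFrameSign
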